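import Literature.MathematicalPhysics.QuantumFieldTheory.Balaban1983to89.B9Thm39OneCubeReadingAtLettersY

/-!
# `Balaban1983to89.B9Conv348AtOneLettersY` — T. Bałaban, *Propagators for lattice gauge theories in a background field*, Commun. Math. Phys. **99**
# (1985) 389–434 [Balaban1985BackgroundPropagators], rows 15–16 of the N06 knit AT THE TRIVIAL BACKGROUND: Theorem 3.2's (3.48) read on the inverse
# ((3.96)) at `U = 1` for def-Y's genuine letter `L39 = Q′G′²Q′*`, on the faithful block map, IS [4] Prop. 2.3 (2.86)–(2.87) OF RECORD — the
# `U = 1` partial witness of substance for rows 15–16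

[4] = T. Bałaban, *Propagators and renormalization transformations for lattice gauge theories. II*, Commun. Math. Phys. **96** (1984) 223–250
[`Balaban1984PropagatorsII`].

statement-level skeleton of published theorems with citation tags; proofs where landed; nothing here is a claim about the Yang–Mills mass gap

THE PRINTED LOCI (verbatim).  [B9] p. 407, Cor. 3.5: *«for U = 1 these theorems are proved in [4]»*; p. 398, Theorem 3.2 (3.48): *«|(Q′(U)G′²(U)
Q′\*(U))⁻¹(y, y′)| ≦ B₀(Lʲη)⁻⁴(L^{j′}η)^{−d}e^{−δ₀d(y,y′)}»*; p. 411 (3.96): *«(Q′G′²Q′\*)⁻¹ = C₀(I − R)⁻¹ … convergent in the weighted supremum norm on 𝔅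
appearing in the inequality (3.48)»*; [4] p. 238, Prop. 2.3 (2.86)–(2.87): *«An inverse of the operator Q′G′²Q′\* is given by the convergent expansion … and
it satisfies the estimate |(Q′G′²Q′\*)⁻¹(y, y′)| ≦ O(1)(Lʲη)⁻⁴(L^{j′}η)^{−d}e^{−½δ₁d(y,y′)}»*; [4] p. 234, Lemma 2.1 (2.61); [4] p. 232 (2.51).

WHY THIS FILE (cell context; referee ref-A's WATCH-JSAT-N06 on dag-n06-d's N06 certificate, 2026-08-27: *«the cheapest partial witness is the TRIVIAL
background U = 1 at one member, where the schemas are [4]'s U = 1 content (B6, in-tree)»*).  n06-j's `B9Thm39OneCubeReadingAtLettersY` (p547421) shows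
that rows 15–16's 24 displayed binders are content-equivalent to ONE display, `Conv348Blk` at the one-cube letters — «`L39(U)` has a two-sided inverse
with block majorant `B₀(Lʲη)⁻⁴e^{−δ₀d}`» — and fires the rows from it (`t39_hksum_oneCube_opsYOfLetters_F` on n06-i's FAITHFUL block map `blk39F`).
THIS FILE PROVES THAT DISPLAY AT THE TRIVIAL BACKGROUND `U = 1` for EVERY letters family `𝔏` (the `U = 1` clauses `parS_one`, `Gp_one` are FIELDS of
def-Y's `CovLettersY`) and every member above a threshold, with NO analytic hypothesis:
* def-Y's `U = 1` dictionary (`Node00.XY_one`: `(Q′G′²Q′*)(1)` is the lift of T8's `XopT`; `toMatrix_XinvEY`, `XopEY_comp_XinvEY`: its matrix inverse is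
  `xinvK = GiM`) gives the two-sided inverse of `L39(1) = realify39 (unit39 • XY … 1)` in real coordinates: `realify39 (unit39⁻¹ • liftMatY xinvK)` (§2);
* T8's torus census of [4] Prop. 2.3 (`B6Prop23KLevelTorusCensus.prop23Printed_kLevelTorusP` = N03's leg h23 `Node00.N03_leg_h23`, node N03 DISCHARGED
  of record) bounds the (2.87)-kernel `cK = CinvTP.ker`; def-Y's `cK_eq_xinvK_mul` and n06-i's `cWtY_mul_unit39` turn it into `unit39⁻¹·|xinvK s s′| ≦
  C·(lenB s)⁻⁴·e^{−½δ₁ d_T(s,s′)}` — the pairing weight `(L^{j′}η)^{−(d+1)}` cancels EXACTLY (§3);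
* [4] Lemma 2.1 (2.61) on the torus blocks of the member above its (2.59)-type threshold (`B6Geom246MultiLevelTorus.lemma21_torus`, the repaired
  constant `K261`; the threshold arithmetic is n06-i's `B9Ineq349SiteFromBlocks.exists_threshold_349` verbatim) sums the fibre of the faithful block map
  over a bond WITHOUT counting it (§4);
* n06-i's faithful-representative facts (`len_rep39F`, `distB_beta_rep39F_le_one`) convert torus-block lengths and distances to the record's at the
  representatives (§5): ★ `hasMajorant_invL39_one_F`.
RESULTS.  ★★ `conv348_oneCubeYF_one` (§6): `∃ M₁ B₀ δ₀ > 0, ∀ 𝔏 bI (level-∕1-faithful) x, M₁ ≦ (geo9Y x).M → Conv348Blk (oneCubeOps39YF θ M⋆ 𝔏 bI x) B₀ δ₀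
1`; ★★ `rows1516_bodies_oneCubeYF_one`: at `U = 1` the four Theorem-3.9 schema bodies of rows 15–16 (`Local348Blk ∧ Identities395Blk ∧ Small285Blk ∧
Factors389Blk`) HOLD at the one-cube letters on the faithful block map, for every letters family and every member above the threshold — rows 15–16's
displayed analysis is [4]'s at the trivial background, in kernel, at def-Y's genuine letters.

HONEST SCOPE.  `U = 1` ONLY (the trivial background, which lies in (3.35) at every member: `B9BackgroundsKLevelV1P.reg335YP_one`); the class needs
Theorem 3.2 proper (not in the tree at def-Y's letters); the block map is n06-i's FAITHFUL one (`blk39F`), not the certificate's `blk39` (see p547421 §4 and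
the located caution on the bus); nothing of [B9] is asserted and [4] enters only through the DISCHARGED torus census; NOT a node discharge, NOT summit
progress; count-neutral; one finite 𝕋⁴ programme — nothing continuum, nothing about the mass gap.  Cell `pub-ymgap` (HUMAN RULING D-0062), Track A node
N06 [B9], seat `pub-ymgap-dag-n06-j` (harness re-seat gen 14), 2026-08-27.  No `sorry`, no `axiom`, no `instance`, no `notation`, no `def`.
-/

noncomputable section

namespace Literature.MathematicalPhysics.QuantumFieldTheory.Balaban1983to89.B9Conv348AtOneLettersY

open Literature.MathematicalPhysics.QuantumFieldTheory.Balaban1983to89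
open Finset B6RandomWalk B9Thm37Sum B9Thm34Ext B9Thm34Inv B9Thm39Whole B9Thm39WholeBlk B9Thm39ReadingCoords B9Thm39ReadingAtLetters
  B9Thm39OneCubeReadingAtLettersY Node00
open B6KLevelCensusIndexV1 B6Geom246MultiLevelBox B6Geom246MultiLevelTorus B6Ineq2142KLevelV1 B6GlobalChartV1 B6Prop22KLevelTorusCensus
  B6Prop22KLevelTorusCensusEta B6Prop23KLevelTorusCensus B6Ineq288MultiLevelTorus B6Ineq261LevelGap B9Ineq349SiteComposite B9Ineq349SiteFromBlocks
  B9Ineq349SiteFromConv348 B9PinMembersKLevelV1 B9PinCarriersKLevelV1 B9PinGeometryKLevelV1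
open scoped Matrix

/-! ## §1 Coordinates of a rescaled lifted matrix -/

section Coords

variable {𝔸 : Type} [NormedRing 𝔸] [NormedAlgebra ℂ 𝔸]
variable {S κ : Type} [Fintype S] [DecidableEq S] [Fintype κ]

omit [DecidableEq S] in
/-- **THE REAL-COORDINATE OPERATOR OF A RESCALED LIFTED REAL MATRIX ACTS COORDINATE-WISE**: `realify39 b (r • liftMatY M) μ (s, c) = r·Σ_{s′} M(s,s′)·μ(s′, c)`
(a real matrix on the block index, the identity on the coordinates of `𝔸`). [cite: Balaban1985BackgroundPropagators, p.389 + (3.48) p.398, dictionary] -/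
theorem realify39_smul_liftMatY_apply (b : Module.Basis κ ℝ 𝔸) (M : Matrix S S ℝ) (r : ℝ) (μ : S × κ → ℝ) (p : S × κ) :
    realify39 b (((r : ℝ) : ℂ) • liftMatY 𝔸 M) μ p = r * ∑ s', M p.1 s' * μ (s', p.2) := by
  have key : (((r : ℝ) : ℂ) • liftMatY 𝔸 M) (coordEquiv39 b μ) =
      coordEquiv39 b (fun q : S × κ => r * ∑ s', M q.1 s' * μ (s', q.2)) := by
    funext s
    rw [LinearMap.smul_apply, Pi.smul_apply, liftMatY_apply, coordEquiv39_apply, Complex.coe_smul]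
    simp_rw [coordEquiv39_apply, Complex.coe_smul, Finset.smul_sum, smul_smul, Finset.mul_sum, Finset.sum_smul]
    rw [Finset.sum_comm]
  rw [realify39_apply, key, LinearEquiv.symm_apply_apply]

end Coords

/-! ## §2 The two-sided inverse of `L39(1)` in real coordinates (def-Y's `U = 1` dictionary) -/

section Inverse

variable {𝔸 : Type} [NormedRing 𝔸] [NormedAlgebra ℂ 𝔸] [CompleteSpace 𝔸] [FiniteDimensional ℂ 𝔸]
variable {d ℓ : ℕ} {hd : 1 ≤ d + 1} {hL : Odd (ℓ + 1) ∧ 1 < ℓ + 1} {b₀ b₁ : ℝ}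

/-- the matrix of `(Q′G′²Q′*)(1)` times `GiM` is `1` (T8's `XopT_mul_GinvT`, through the matrices). [cite: Balaban1984PropagatorsII, (2.86) p.238 + p.235 («its inverse is well defined»)] -/
theorem xMat_mul_xinvK (i : KIdx d ℓ hd hL b₀ b₁) : LinearMap.toMatrix' (XopEY i) * xinvK i = 1 := by
  rw [← toMatrix_XinvEY, ← LinearMap.toMatrix'_comp, XopEY_comp_XinvEY, LinearMap.toMatrix'_id]

/-- … and `GiM` times it is `1` (square matrices). [cite: Balaban1984PropagatorsII, (2.86) p.238, bookkeeping] -/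
theorem xinvK_mul_xMat (i : KIdx d ℓ hd hL b₀ b₁) : xinvK i * LinearMap.toMatrix' (XopEY i) = 1 :=
  mul_eq_one_comm.mp (xMat_mul_xinvK i)

/-- ★ **`L39(1)` IN def-Y's `U = 1` DICTIONARY**: for any letters with the printed `U = 1` clauses (`parS(1) = 1`, `G′(1)` = the lift of T8's `G`),
`L39 … 1 = realify39 (unit39 • liftMatY (matrix of XopT))`. [cite: Balaban1985BackgroundPropagators, Cor. 3.5 p.407 («for U = 1 … proved in [4]») + (3.25) p.395; Balaban1984PropagatorsII, (2.69) p.235] -/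
theorem L39_one_eq (i : KIdx d ℓ hd hL b₀ b₁) (parS : SiteParY 𝔸 i) (Gp : SiteOpY 𝔸 i) (hparS : ∀ z w, parS (fun _ _ => 1) z w = 1)
    (hGp : ∀ (f : SiteY i → ℝ) (E : 𝔸), Gp (fun _ _ => 1) (liftY f E) = liftY ((toKT i).G *ᵥ f) E) :
    L39 i parS Gp (fun _ _ => 1) = realify39 (basis39 𝔸) (((unit39 i : ℝ) : ℂ) • liftMatY 𝔸 (LinearMap.toMatrix' (XopEY i))) := by
  show realify39 (basis39 𝔸) (((unit39 i : ℝ) : ℂ) • XY i parS Gp (fun _ _ => 1)) = _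
  rw [XY_one i hparS hGp, liftEndY_eq_liftMatY]

/-- ★ **THE TWO-SIDED INVERSE OF `L39(1)`**: `T₁ := realify39 (unit39⁻¹ • liftMatY GiM)` satisfies `T₁·L39(1) = 1 = L39(1)·T₁`.
[cite: Balaban1985BackgroundPropagators, (3.96) p.411 + Cor. 3.5 p.407; Balaban1984PropagatorsII, (2.86) p.238] -/
theorem invL39_one_two_sided (i : KIdx d ℓ hd hL b₀ b₁) (parS : SiteParY 𝔸 i) (Gp : SiteOpY 𝔸 i)
    (hparS : ∀ z w, parS (fun _ _ => 1) z w = 1)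
    (hGp : ∀ (f : SiteY i → ℝ) (E : 𝔸), Gp (fun _ _ => 1) (liftY f E) = liftY ((toKT i).G *ᵥ f) E) :
    realify39 (basis39 𝔸) ((((unit39 i)⁻¹ : ℝ) : ℂ) • liftMatY 𝔸 (xinvK i)) * L39 i parS Gp (fun _ _ => 1) = 1 ∧
      L39 i parS Gp (fun _ _ => 1) * realify39 (basis39 𝔸) ((((unit39 i)⁻¹ : ℝ) : ℂ) • liftMatY 𝔸 (xinvK i)) = 1 := by
  have hu : ((unit39 i : ℝ) : ℂ) ≠ 0 := by exact_mod_cast (unit39_pos i).ne'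
  have h1 : ((((unit39 i)⁻¹ : ℝ) : ℂ) • liftMatY 𝔸 (xinvK i)) * (((unit39 i : ℝ) : ℂ) • liftMatY 𝔸 (LinearMap.toMatrix' (XopEY i))) = 1 := by
    rw [smul_mul_smul_comm, Complex.ofReal_inv, inv_mul_cancel₀ hu, one_smul, Module.End.mul_eq_comp, ← liftMatY_mul, xinvK_mul_xMat,
      liftMatY_one]
    rfl
  have h2 : (((unit39 i : ℝ) : ℂ) • liftMatY 𝔸 (LinearMap.toMatrix' (XopEY i))) * ((((unit39 i)⁻¹ : ℝ) : ℂ) • liftMatY 𝔸 (xinvK i)) = 1 := by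
    rw [smul_mul_smul_comm, Complex.ofReal_inv, mul_inv_cancel₀ hu, one_smul, Module.End.mul_eq_comp, ← liftMatY_mul, xMat_mul_xinvK,
      liftMatY_one]
    rfl
  rw [L39_one_eq i parS Gp hparS hGp, ← realify39_mul, ← realify39_mul, h1, h2, realify39_one]
  exact ⟨rfl, rfl⟩

end Inverse

/-! ## §3 [4] Prop. 2.3 OF RECORD read on `unit39⁻¹·GiM`: the pairing weight cancels -/

section Prop23

variable {d ℓ : ℕ} {hd : 1 ≤ d + 1} {hL : Odd (ℓ + 1) ∧ 1 < ℓ + 1} {b₀ b₁ : ℝ} {Mstar : ℕ}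

variable (d ℓ hd hL b₀ b₁ Mstar) in
/-- ★ **(2.87) OF RECORD FOR `unit39⁻¹·GiM` AT THE MEMBERS OF STAGE 3′(Y)**: there are `M₀, δ₁, C > 0` (T8's census constants; functions of `d, L`) such
that for every member with `L·M_h ≧ M₀` and all blocks `s, s′`: `unit39⁻¹·|GiM(s, s′)| ≦ C·(Lʲη)(s)⁻⁴·e^{−½δ₁ d_T(s,s′)}` — T8's `prop23Printed_kLevelTorusP`
at `toKT x.toKIdx` (`cK = CinvTP.ker = GiM·cWtY`), the weight `cWtY(s′)·unit39 = ((L^{j′}η)^{d+1})⁻¹` (print's units `c_f = Lᵏ`) cancelling (2.87)'s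
`(L^{j′}η)^{−(d+1)}`. [cite: Balaban1984PropagatorsII, Prop. 2.3 (2.86)–(2.87) p.238; Balaban1985BackgroundPropagators, (3.48) p.398 (units)] -/
theorem exists_xinvK_bound (hℓ : 1 ≤ ℓ) : ∃ M₀ δ₁ C : ℝ, 0 < M₀ ∧ 0 < δ₁ ∧ 0 < C ∧
    ∀ x : MemberY d ℓ hd hL b₀ b₁ Mstar, M₀ ≤ (geo9Y x).M → ∀ s s' : BlkY x.toKIdx,
      (unit39 x.toKIdx)⁻¹ * |xinvK x.toKIdx s s'| ≤ C * lenB x.toKIdx s ^ (-(4 : ℝ)) * Real.exp (-(δ₁ / 2 * distB x.toKIdx s s')) := by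
  obtain ⟨M₀, δ₁, C, hM₀, hδ₁, hC, h⟩ := prop23Printed_kLevelTorusP d ℓ hℓ
  refine ⟨M₀, δ₁, C, hM₀, hδ₁, hC, fun x hM s s' => ?_⟩
  have hMT : M₀ ≤ (geoTP (toKT x.toKIdx)).M := by
    rw [geo9Y_M_eq] at hM
    show M₀ ≤ ((ℓ : ℝ) + 1) * ((toKT x.toKIdx).Mh : ℝ)
    exact hM
  have hb : |cK x.toKIdx s s'| ≤ C * lenB x.toKIdx s ^ (-(4 : ℝ)) * lenB x.toKIdx s' ^ (-((d + 1 : ℕ) : ℝ)) *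
      Real.exp (-(δ₁ / 2 * distB x.toKIdx s s')) :=
    h (toKT x.toKIdx) trivial hMT s s'
  have hw : 0 < cWtY x.toKIdx s' := B9Ineq349SiteComposite.cWtY_pos x.toKIdx s'
  have hu : 0 < unit39 x.toKIdx := unit39_pos x.toKIdx
  have hl : 0 < lenB x.toKIdx s' := lenB_pos x.toKIdx s'
  have hcK : cK x.toKIdx s s' = xinvK x.toKIdx s s' * cWtY x.toKIdx s' := cK_eq_xinvK_mul x.toKIdx s s'
  have hcu : cWtY x.toKIdx s' * unit39 x.toKIdx = (lenB x.toKIdx s' ^ (d + 1))⁻¹ := cWtY_mul_unit39 x s'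
  have hx : (unit39 x.toKIdx)⁻¹ * |xinvK x.toKIdx s s'| = |cK x.toKIdx s s'| * lenB x.toKIdx s' ^ (d + 1) := by
    have e1 : (unit39 x.toKIdx)⁻¹ * |xinvK x.toKIdx s s'| =
        |xinvK x.toKIdx s s'| * cWtY x.toKIdx s' * (cWtY x.toKIdx s' * unit39 x.toKIdx)⁻¹ := by
      field_simp
    rw [e1, hcu, inv_inv, hcK, abs_mul, abs_of_pos hw]
  have hpow : lenB x.toKIdx s' ^ (-((d + 1 : ℕ) : ℝ)) * lenB x.toKIdx s' ^ (d + 1) = 1 := by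
    rw [Real.rpow_neg hl.le, Real.rpow_natCast, inv_mul_cancel₀ (pow_ne_zero _ hl.ne')]
  rw [hx]
  calc |cK x.toKIdx s s'| * lenB x.toKIdx s' ^ (d + 1)
      ≤ C * lenB x.toKIdx s ^ (-(4 : ℝ)) * lenB x.toKIdx s' ^ (-((d + 1 : ℕ) : ℝ)) *
          Real.exp (-(δ₁ / 2 * distB x.toKIdx s s')) * lenB x.toKIdx s' ^ (d + 1) :=
        mul_le_mul_of_nonneg_right hb (pow_nonneg hl.le _)
    _ = C * lenB x.toKIdx s ^ (-(4 : ℝ)) * Real.exp (-(δ₁ / 2 * distB x.toKIdx s s')) *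
          (lenB x.toKIdx s' ^ (-((d + 1 : ℕ) : ℝ)) * lenB x.toKIdx s' ^ (d + 1)) := by ring
    _ = C * lenB x.toKIdx s ^ (-(4 : ℝ)) * Real.exp (-(δ₁ / 2 * distB x.toKIdx s s')) := by rw [hpow, mul_one]

end Prop23

/-! ## §4 [4] Lemma 2.1 (2.61) on the torus blocks of a member above a threshold (n06-i's threshold arithmetic, verbatim) -/

section RowSum

variable {d ℓ : ℕ} {hd : 1 ≤ d + 1} {hL : Odd (ℓ + 1) ∧ 1 < ℓ + 1} {b₀ b₁ : ℝ}

variable (d ℓ hd hL b₀ b₁) in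
/-- **(2.61) AT RATE `½δ` ON THE TORUS BLOCKS OF EVERY MEMBER ABOVE A THRESHOLD**: for `δ > 0` there are `M₃ > 0` and `c_L ≧ 0` (the repaired
constant `K261`) with `Σ_{y′∈𝔅} e^{−½δ d_T(y, y′)} ≦ c_L` for every index `i` with `L·M_h ≧ M₃` — `lemma21_torus` with its (2.59)-type threshold
`N₀ + 1 ≦ R·L·M_h`, `e^{−½δ}L^{2(d+1)∕N₀} < 1` discharged from `L·M_h ≧ N₀ + 1` (`R ≧ 1`), as in `B9Ineq349SiteFromBlocks.exists_threshold_349`.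
[cite: Balaban1984PropagatorsII, Lemma 2.1 (2.61) p.234, (2.59) p.233] -/
theorem exists_rowSum_blocks {δ : ℝ} (hδ : 0 < δ) : ∃ M₃ cL : ℝ, 0 < M₃ ∧ 0 ≤ cL ∧
    ∀ i : KIdx d ℓ hd hL b₀ b₁, M₃ ≤ ((ℓ : ℝ) + 1) * i.Mh →
      ∀ y : BlkY i, ∑ y' : BlkY i, Real.exp (-(1 / 2 * δ * distB i y y')) ≤ cL := by
  have hL0 : (0 : ℝ) < (ℓ : ℝ) + 1 := by positivity
  have hL1 : (1 : ℝ) ≤ (ℓ : ℝ) + 1 := by linarith [(Nat.cast_nonneg ℓ : (0 : ℝ) ≤ ℓ)]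
  have hlog : Real.log ((ℓ : ℝ) + 1) ≤ (ℓ : ℝ) + 1 := (Real.log_le_sub_one_of_pos hL0).trans (by linarith)
  obtain ⟨N₁, hN₁⟩ : ∃ N₁ : ℕ, N₁ = ⌈8 * ((d : ℝ) + 1) * ((ℓ : ℝ) + 1) / δ⌉₊ + 1 := ⟨_, rfl⟩
  have hN₁pos : 0 < N₁ := by rw [hN₁]; omega
  have hN₁ge : 8 * ((d : ℝ) + 1) * ((ℓ : ℝ) + 1) < δ * (N₁ : ℝ) := by
    have h : 8 * ((d : ℝ) + 1) * ((ℓ : ℝ) + 1) / δ < (N₁ : ℝ) := by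
      rw [hN₁]; push_cast; exact lt_of_le_of_lt (Nat.le_ceil _) (by linarith)
    rw [div_lt_iff₀ hδ] at h; linarith
  have hθ1 : Real.exp (-(1 / 2 * δ)) * ((ℓ : ℝ) + 1) ^ ((2 * (d + 1 : ℕ) : ℝ) / N₁) < 1 := by
    refine theta_lt_one_of_log hL0 hN₁pos ?_
    push_cast
    have hd0 : (0 : ℝ) ≤ 2 * ((d : ℝ) + 1) := by positivity
    have h1 := mul_le_mul_of_nonneg_left hlog hd0
    have h2 : (0 : ℝ) ≤ ((d : ℝ) + 1) * ((ℓ : ℝ) + 1) := by positivity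
    linarith
  obtain ⟨cL, hcL⟩ : ∃ cL : ℝ, cL = K261 N₁ (d + 1) ((ℓ : ℝ) + 1) 1 (1 / 2 * δ) := ⟨_, rfl⟩
  have hcL0 : 0 ≤ cL := by rw [hcL]; exact K261_nonneg (by positivity) zero_le_one
  refine ⟨(N₁ : ℝ) + 1, cL, by positivity, hcL0, fun i hM y => ?_⟩
  have hR1 : 1 ≤ i.R := le_trans (by omega) (toKT i).hR
  have hRM1 : N₁ + 1 ≤ (toKT i).R * ((ℓ + 1) * (toKT i).Mh) := by
    have h1 : ((N₁ + 1 : ℕ) : ℝ) ≤ (((ℓ + 1) * i.Mh : ℕ) : ℝ) := by push_cast; exact hM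
    have h2 : N₁ + 1 ≤ (ℓ + 1) * i.Mh := by exact_mod_cast h1
    exact h2.trans (Nat.le_mul_of_pos_left _ hR1)
  obtain ⟨-, h261, -, -⟩ :=
    lemma21_torus i.D (toKT i).hMh (toKT i).hP hN₁pos hRM1 hδ.le (α := 1 / 2) (by norm_num) (by norm_num) hθ1
  rw [hcL]
  exact h261 y

end RowSum

/-! ## §5 The block majorant of the inverse of `L39(1)` on the faithful block map -/

section Majorant

variable {𝔸 : Type} [NormedRing 𝔸] [NormedAlgebra ℂ 𝔸] [CompleteSpace 𝔸] [FiniteDimensional ℂ 𝔸]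
variable {d ℓ : ℕ} {hd : 1 ≤ d + 1} {hL : Odd (ℓ + 1) ∧ 1 < ℓ + 1} {b₀ b₁ : ℝ} {Mstar : ℕ}

/-- `e^{−2ρ a} ≤ e^{ρ}·e^{−ρ b}·e^{−ρ a}` whenever `b ≤ a + 1` (`ρ ≥ 0`): half of the decay is spent on the triangle inequality. [cite: Balaban1984PropagatorsII, (2.54) p.233, bookkeeping] -/
private theorem exp_split {ρ a b : ℝ} (hρ : 0 ≤ ρ) (hab : b ≤ a + 1) :
    Real.exp (-(2 * ρ * a)) ≤ Real.exp ρ * Real.exp (-(ρ * b)) * Real.exp (-(ρ * a)) := by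
  rw [← Real.exp_add, ← Real.exp_add]
  apply Real.exp_le_exp.2
  nlinarith [mul_le_mul_of_nonneg_left hab hρ]

omit [CompleteSpace 𝔸] in
/-- ★ **THE INVERSE OF `L39(1)` HAS THE (3.48)-SHAPE BLOCK MAJORANT ON THE FAITHFUL BLOCK MAP**: given (2.87) for `unit39⁻¹·GiM` with `(C, δ₁)` and the
torus-block row sum `Σ_{s′} e^{−¼δ₁ d_T(s,s′)} ≦ c_L` at the member, and a level-∕1-faithful bond map `bI` (`hlev`, `hβ1`), the real-coordinate operator
`T₁ = realify39 (unit39⁻¹ • liftMatY GiM)` satisfies [4] (2.51) w.r.t. `blk39F … bI` with `K(y, y′) = C·c_L·e^{½δ₁}·(Lʲη)(y)⁻⁴·e^{−¼δ₁ d(y,y′)}` — the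
fibre of `blk39F` over `y′` is summed through (2.61), torus lengths and distances are the record's at the faithful representatives (`len_rep39F`,
`distB_beta_rep39F_le_one`). [cite: Balaban1984PropagatorsII, (2.51) p.232 + Prop. 2.3 (2.87) p.238 + Lemma 2.1 (2.61) p.234 + (2.54) p.233; Balaban1985BackgroundPropagators, (3.48) p.398] -/
theorem hasMajorant_invL39_one_F (x : MemberY d ℓ hd hL b₀ b₁ Mstar) [Fintype (geo9Y x).Site]
    {bI : FBondY x.toKIdx → IBondY x.toKIdx}
    (hβ1 : ∀ f : FBondY x.toKIdx, (geomT x.D).dist (β x.hN x.D x.hk (bI f)) (blkV1 x.hN x.D f) ≤ 1)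
    (hlev : ∀ f : FBondY x.toKIdx, lvl x.hN x.D x.hk (bI f) = (blkV1 x.hN x.D f).1.1)
    {C δ₁ cL : ℝ} (hC : 0 ≤ C) (hδ₁ : 0 ≤ δ₁) (hcL : 0 ≤ cL)
    (hprop : ∀ s s' : BlkY x.toKIdx,
      (unit39 x.toKIdx)⁻¹ * |xinvK x.toKIdx s s'| ≤ C * lenB x.toKIdx s ^ (-(4 : ℝ)) * Real.exp (-(δ₁ / 2 * distB x.toKIdx s s')))
    (hrow : ∀ y : BlkY x.toKIdx, ∑ y' : BlkY x.toKIdx, Real.exp (-(1 / 2 * (δ₁ / 2) * distB x.toKIdx y y')) ≤ cL) :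
    HasMajorant (g := b6 (geo9Y x)) (blk39F 𝔸 x.toKIdx bI)
      (realify39 (basis39 𝔸) ((((unit39 x.toKIdx)⁻¹ : ℝ) : ℂ) • liftMatY 𝔸 (xinvK x.toKIdx)))
      (fun (a b : (geo9Y x).Site) => (C * cL * Real.exp (δ₁ / 2)) * (geo9Y x).len a ^ (-(4 : ℝ)) *
        Real.exp (-(δ₁ / 4 * (geo9Y x).dist a b))) := by
  classical
  intro y' μ Bd hμ p
  obtain ⟨s, c⟩ := p
  have hρ0 : (0 : ℝ) ≤ δ₁ / 4 := by positivity
  have hBd : 0 ≤ Bd := hμ.nonneg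
  -- the value of `T₁ μ` at `(s, c)`
  rw [realify39_smul_liftMatY_apply]
  -- the torus facts at the faithful representatives
  have hnear : ∀ s' : BlkY x.toKIdx, blk39F 𝔸 x.toKIdx bI (s', c) = y' →
      distB x.toKIdx s (β x.hN x.D x.hk y') ≤ distB x.toKIdx s s' + 1 := by
    intro s' hs'
    have hs'' : rep39F x.toKIdx bI s' = y' := hs'
    have h1 : distB x.toKIdx (β x.hN x.D x.hk y') s' ≤ 1 := by
      have := distB_beta_rep39F_le_one x hβ1 s'
      rwa [hs''] at this
    have h2 : distB x.toKIdx s' (β x.hN x.D x.hk y') ≤ 1 := by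
      have hsymm : distB x.toKIdx s' (β x.hN x.D x.hk y') = distB x.toKIdx (β x.hN x.D x.hk y') s' := dist_symm_geoBT (toKT x.toKIdx) _ _
      rw [hsymm]; exact h1
    linarith [distB_triangle x.toKIdx s s' (β x.hN x.D x.hk y')]
  -- termwise bound
  have hterm : ∀ s' : BlkY x.toKIdx, |(unit39 x.toKIdx)⁻¹ * (xinvK x.toKIdx s s' * μ (s', c))| ≤
      C * lenB x.toKIdx s ^ (-(4 : ℝ)) * Real.exp (δ₁ / 4) * Real.exp (-((δ₁ / 4) * distB x.toKIdx s (β x.hN x.D x.hk y'))) * Bd *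
        Real.exp (-(1 / 2 * (δ₁ / 2) * distB x.toKIdx s s')) := by
    intro s'
    have hK0 : 0 ≤ C * lenB x.toKIdx s ^ (-(4 : ℝ)) * Real.exp (δ₁ / 4) * Real.exp (-((δ₁ / 4) * distB x.toKIdx s (β x.hN x.D x.hk y'))) * Bd *
        Real.exp (-(1 / 2 * (δ₁ / 2) * distB x.toKIdx s s')) := by
      have := Real.rpow_nonneg (lenB_pos x.toKIdx s).le (-(4 : ℝ))
      positivity
    by_cases hs' : blk39F 𝔸 x.toKIdx bI (s', c) = y'
    · have hμb : |μ (s', c)| ≤ Bd := hμ.bound (s', c) hs'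
      have h12 : Real.exp (-(δ₁ / 2 * distB x.toKIdx s s')) ≤
          Real.exp (δ₁ / 4) * Real.exp (-((δ₁ / 4) * distB x.toKIdx s (β x.hN x.D x.hk y'))) * Real.exp (-(1 / 2 * (δ₁ / 2) * distB x.toKIdx s s')) := by
        have e1 : δ₁ / 2 * distB x.toKIdx s s' = 2 * (δ₁ / 4) * distB x.toKIdx s s' := by ring
        have e2 : 1 / 2 * (δ₁ / 2) * distB x.toKIdx s s' = (δ₁ / 4) * distB x.toKIdx s s' := by ring
        rw [e1, e2]
        exact exp_split hρ0 (hnear s' hs')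
      rw [abs_mul, abs_mul, abs_of_pos (inv_pos.2 (unit39_pos x.toKIdx))]
      calc (unit39 x.toKIdx)⁻¹ * (|xinvK x.toKIdx s s'| * |μ (s', c)|)
          = ((unit39 x.toKIdx)⁻¹ * |xinvK x.toKIdx s s'|) * |μ (s', c)| := by ring
        _ ≤ (C * lenB x.toKIdx s ^ (-(4 : ℝ)) * Real.exp (-(δ₁ / 2 * distB x.toKIdx s s'))) * Bd :=
            mul_le_mul (hprop s s') hμb (abs_nonneg _)
              (mul_nonneg (mul_nonneg hC (Real.rpow_nonneg (lenB_pos x.toKIdx s).le _)) (Real.exp_pos _).le)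
        _ ≤ (C * lenB x.toKIdx s ^ (-(4 : ℝ)) *
              (Real.exp (δ₁ / 4) * Real.exp (-((δ₁ / 4) * distB x.toKIdx s (β x.hN x.D x.hk y'))) * Real.exp (-(1 / 2 * (δ₁ / 2) * distB x.toKIdx s s')))) * Bd :=
            mul_le_mul_of_nonneg_right (mul_le_mul_of_nonneg_left h12 (mul_nonneg hC (Real.rpow_nonneg (lenB_pos x.toKIdx s).le _))) hBd
        _ = _ := by ring
    · have hμ0 : μ (s', c) = 0 := hμ.off (s', c) hs'
      rw [hμ0, mul_zero, mul_zero, abs_zero]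
      exact hK0
  -- sum and (2.61)
  have hsum : |(unit39 x.toKIdx)⁻¹ * ∑ s', xinvK x.toKIdx s s' * μ (s', c)| ≤
      C * lenB x.toKIdx s ^ (-(4 : ℝ)) * Real.exp (δ₁ / 4) * Real.exp (-((δ₁ / 4) * distB x.toKIdx s (β x.hN x.D x.hk y'))) * Bd * cL := by
    rw [Finset.mul_sum]
    refine (Finset.abs_sum_le_sum_abs _ _).trans ?_
    refine (Finset.sum_le_sum fun s' _ => hterm s').trans ?_
    rw [← Finset.mul_sum]
    refine mul_le_mul_of_nonneg_left (hrow s) ?_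
    have := Real.rpow_nonneg (lenB_pos x.toKIdx s).le (-(4 : ℝ))
    positivity
  -- lengths and distances at the faithful representatives
  have hlen : lenB x.toKIdx s = (geo9Y x).len (blk39F 𝔸 x.toKIdx bI (s, c)) := (len_rep39F x hlev s).symm
  have hdist : (geo9Y x).dist (blk39F 𝔸 x.toKIdx bI (s, c)) y' ≤ distB x.toKIdx s (β x.hN x.D x.hk y') + 1 := by
    show (geo9Y x).dist (rep39F x.toKIdx bI s) y' ≤ _
    rw [geo9Y_dist_eq_distB]
    have h1 : distB x.toKIdx (β x.hN x.D x.hk (rep39F x.toKIdx bI s)) s ≤ 1 := distB_beta_rep39F_le_one x hβ1 s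
    linarith [distB_triangle x.toKIdx (β x.hN x.D x.hk (rep39F x.toKIdx bI s)) s (β x.hN x.D x.hk y')]
  have hexp : Real.exp (-((δ₁ / 4) * distB x.toKIdx s (β x.hN x.D x.hk y'))) ≤
      Real.exp (δ₁ / 4) * Real.exp (-((δ₁ / 4) * (geo9Y x).dist (blk39F 𝔸 x.toKIdx bI (s, c)) y')) := by
    rw [← Real.exp_add]
    apply Real.exp_le_exp.2
    nlinarith [mul_le_mul_of_nonneg_left hdist hρ0]
  refine hsum.trans ?_
  rw [hlen]
  have hl4 : 0 ≤ (geo9Y x).len (blk39F 𝔸 x.toKIdx bI (s, c)) ^ (-(4 : ℝ)) := by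
    rw [← hlen]; exact Real.rpow_nonneg (lenB_pos x.toKIdx s).le _
  calc C * (geo9Y x).len (blk39F 𝔸 x.toKIdx bI (s, c)) ^ (-(4 : ℝ)) * Real.exp (δ₁ / 4) * Real.exp (-((δ₁ / 4) * distB x.toKIdx s (β x.hN x.D x.hk y'))) * Bd * cL
      ≤ C * (geo9Y x).len (blk39F 𝔸 x.toKIdx bI (s, c)) ^ (-(4 : ℝ)) * Real.exp (δ₁ / 4) *
          (Real.exp (δ₁ / 4) * Real.exp (-((δ₁ / 4) * (geo9Y x).dist (blk39F 𝔸 x.toKIdx bI (s, c)) y'))) * Bd * cL := by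
        have h0 : 0 ≤ C * (geo9Y x).len (blk39F 𝔸 x.toKIdx bI (s, c)) ^ (-(4 : ℝ)) * Real.exp (δ₁ / 4) := by positivity
        exact mul_le_mul_of_nonneg_right (mul_le_mul_of_nonneg_right (mul_le_mul_of_nonneg_left hexp h0) hBd) hcL
    _ = C * cL * Real.exp (δ₁ / 2) * (geo9Y x).len (blk39F 𝔸 x.toKIdx bI (s, c)) ^ (-(4 : ℝ)) *
          Real.exp (-(δ₁ / 4 * (geo9Y x).dist (blk39F 𝔸 x.toKIdx bI (s, c)) y')) * Bd := by
        have e : Real.exp (δ₁ / 2) = Real.exp (δ₁ / 4) * Real.exp (δ₁ / 4) := by rw [← Real.exp_add]; ring_nf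
        rw [e]
        ring

end Majorant

/-! ## §6 At def-Y's letters: `(3.48)⁻¹` at `U = 1` on the faithful block map; rows 15–16's bodies at the trivial background -/

section StageY

open scoped Matrix.Norms.L2Operator
open B7Prop2SpecialUnitary

variable {N : ℕ} (θ : Stage3Params) (Mstar : ℕ)
variable [∀ x : MemberY θ.d₆ θ.ℓ₆ θ.hd' θ.hL' θ.b₀ θ.b₁ Mstar, Fintype (geo9Y x).Site]
  [∀ x : MemberY θ.d₆ θ.ℓ₆ θ.hd' θ.hL' θ.b₀ θ.b₁ Mstar, DecidableEq (geo9Y x).Site]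

omit [∀ x : MemberY θ.d₆ θ.ℓ₆ θ.hd' θ.hL' θ.b₀ θ.b₁ Mstar, DecidableEq (geo9Y x).Site] in
/-- ★★ **`(3.48)⁻¹` AT THE TRIVIAL BACKGROUND IS [4] PROP. 2.3 OF RECORD**: there are `M₁, B₀, δ₀ > 0` (functions of `d, L`; T8's census and the
repaired (2.61) constant) such that for EVERY letters family `𝔏` (def-Y's `CovLettersY`: the `U = 1` clauses are its fields), every level-∕1-faithful bond
map `bI` and every member `x` of Stage 3′(Y) with `M₁ ≦ M`:  `Conv348Blk (oneCubeOps39YF θ M⋆ 𝔏 bI x) B₀ δ₀ 1` — the genuine `L39(1) = Q′G′(1)²Q′*` in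
print's units and real coordinates has a two-sided inverse with the block majorant `B₀(Lʲη)⁻⁴e^{−δ₀d}` w.r.t. `blk39F … (bI x)`.  The ONE display of rows
15–16 (p547421), at `U = 1`, with no analytic hypothesis. [cite: Balaban1985BackgroundPropagators, Thm 3.2 (3.48) p.398 + (3.96) p.411 + Cor. 3.5 p.407 («for U = 1 … proved in [4]»); Balaban1984PropagatorsII, Prop. 2.3 (2.86)–(2.87) p.238 + Lemma 2.1 (2.61) p.234 + (2.51) p.232] -/
theorem conv348_oneCubeYF_one : ∃ M₁ B₀ δ₀ : ℝ, 0 < M₁ ∧ 0 < B₀ ∧ 0 < δ₀ ∧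
    ∀ (𝔏 : LettersY N θ Mstar) (bI : ∀ x : MemberY θ.d₆ θ.ℓ₆ θ.hd' θ.hL' θ.b₀ θ.b₁ Mstar, FBondY x.toKIdx → IBondY x.toKIdx)
      (_hβ1 : ∀ (x : MemberY θ.d₆ θ.ℓ₆ θ.hd' θ.hL' θ.b₀ θ.b₁ Mstar) (f : FBondY x.toKIdx),
        (geomT x.D).dist (β x.hN x.D x.hk (bI x f)) (blkV1 x.hN x.D f) ≤ 1)
      (_hlev : ∀ (x : MemberY θ.d₆ θ.ℓ₆ θ.hd' θ.hL' θ.b₀ θ.b₁ Mstar) (f : FBondY x.toKIdx), lvl x.hN x.D x.hk (bI x f) = (blkV1 x.hN x.D f).1.1)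
      (x : MemberY θ.d₆ θ.ℓ₆ θ.hd' θ.hL' θ.b₀ θ.b₁ Mstar), M₁ ≤ (geo9Y x).M →
        Conv348Blk (oneCubeOps39YF θ Mstar 𝔏 bI x) B₀ δ₀ (bg9Y (Matrix (Fin N) (Fin N) ℂ) (specialUnitaryUnits (Fin N)) x).one := by
  obtain ⟨M₀, δ₁, C, hM₀, hδ₁, hC, hprop⟩ := exists_xinvK_bound θ.d₆ θ.ℓ₆ θ.hd' θ.hL' θ.b₀ θ.b₁ Mstar θ.one_le_ℓ₆
  obtain ⟨M₃, cL, hM₃, hcL, hrow⟩ := exists_rowSum_blocks θ.d₆ θ.ℓ₆ θ.hd' θ.hL' θ.b₀ θ.b₁ (half_pos hδ₁)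
  refine ⟨max M₀ M₃, C * (cL + 1) * Real.exp (δ₁ / 2), δ₁ / 4, lt_max_of_lt_left hM₀, by positivity, by positivity,
    fun 𝔏 bI hβ1 hlev x hM => ?_⟩
  have hM0 : M₀ ≤ (geo9Y x).M := (le_max_left _ _).trans hM
  have hM3 : M₃ ≤ ((θ.ℓ₆ : ℝ) + 1) * x.Mh := by rw [← geo9Y_M_eq]; exact (le_max_right _ _).trans hM
  have hrow' : ∀ y : BlkY x.toKIdx, ∑ y' : BlkY x.toKIdx, Real.exp (-(1 / 2 * (δ₁ / 2) * distB x.toKIdx y y')) ≤ cL + 1 :=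
    fun y => (hrow x.toKIdx hM3 y).trans (by linarith)
  refine ⟨realify39 (basis39 (Matrix (Fin N) (Fin N) ℂ)) ((((unit39 x.toKIdx)⁻¹ : ℝ) : ℂ) • liftMatY (Matrix (Fin N) (Fin N) ℂ) (xinvK x.toKIdx)),
    (invL39_one_two_sided x.toKIdx (𝔏 x).parS (𝔏 x).Gp (𝔏 x).parS_one (𝔏 x).Gp_one).1,
    (invL39_one_two_sided x.toKIdx (𝔏 x).parS (𝔏 x).Gp (𝔏 x).parS_one (𝔏 x).Gp_one).2, ?_⟩
  exact hasMajorant_invL39_one_F x (hβ1 x) (hlev x) hC.le hδ₁.le (by linarith) (hprop x hM0) hrow'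

/-- ★★ **ROWS 15–16's DISPLAYED ANALYSIS AT THE TRIVIAL BACKGROUND — THE FOUR THEOREM-3.9 SCHEMA BODIES HOLD AT `U = 1`** at the one-cube letters on
the faithful block map, for every letters family and every member above the threshold: `Local348Blk ∧ Identities395Blk ∧ Small285Blk ∧ Factors389Blk`
at `U = 1` with the constants of `conv348_oneCubeYF_one` (`θ₀ := 0`, any rate `r`) — the `U = 1` partial witness of substance for rows 15–16 (ref-A's
WATCH-JSAT-N06), by p547421's `schemas39_oneCube_of_conv348`; the statics `StaticOK39Blk … 1` and `Locality39Blk` hold outright (p547421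
`staticOK39Blk_oneCube`, `locality39Blk_oneCube`). [cite: Balaban1985BackgroundPropagators, Thm 3.2 (3.48) p.398 + (3.87) p.409 + (3.95)–(3.96) p.411 + Cor. 3.5 p.407; Balaban1984PropagatorsII, Prop. 2.3 (2.86)–(2.87) p.238] -/
theorem rows1516_bodies_oneCubeYF_one (r : ℝ) : ∃ M₁ B₀ δ₀ : ℝ, 0 < M₁ ∧ 0 < B₀ ∧ 0 < δ₀ ∧
    ∀ (𝔏 : LettersY N θ Mstar) (bI : ∀ x : MemberY θ.d₆ θ.ℓ₆ θ.hd' θ.hL' θ.b₀ θ.b₁ Mstar, FBondY x.toKIdx → IBondY x.toKIdx)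
      (_hβ1 : ∀ (x : MemberY θ.d₆ θ.ℓ₆ θ.hd' θ.hL' θ.b₀ θ.b₁ Mstar) (f : FBondY x.toKIdx),
        (geomT x.D).dist (β x.hN x.D x.hk (bI x f)) (blkV1 x.hN x.D f) ≤ 1)
      (_hlev : ∀ (x : MemberY θ.d₆ θ.ℓ₆ θ.hd' θ.hL' θ.b₀ θ.b₁ Mstar) (f : FBondY x.toKIdx), lvl x.hN x.D x.hk (bI x f) = (blkV1 x.hN x.D f).1.1)
      (x : MemberY θ.d₆ θ.ℓ₆ θ.hd' θ.hL' θ.b₀ θ.b₁ Mstar), M₁ ≤ (geo9Y x).M →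
        Local348Blk (oneCubeOps39YF θ Mstar 𝔏 bI x) B₀ δ₀ (bg9Y (Matrix (Fin N) (Fin N) ℂ) (specialUnitaryUnits (Fin N)) x).one ∧
        Identities395Blk (oneCubeOps39YF θ Mstar 𝔏 bI x) (bg9Y (Matrix (Fin N) (Fin N) ℂ) (specialUnitaryUnits (Fin N)) x).one ∧
        Small285Blk (oneCubeOps39YF θ Mstar 𝔏 bI x) 0 r (bg9Y (Matrix (Fin N) (Fin N) ℂ) (specialUnitaryUnits (Fin N)) x).one ∧
        Factors389Blk (oneCubeOps39YF θ Mstar 𝔏 bI x) 0 δ₀ (bg9Y (Matrix (Fin N) (Fin N) ℂ) (specialUnitaryUnits (Fin N)) x).one := by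
  classical
  obtain ⟨M₁, B₀, δ₀, hM₁, hB₀, hδ₀, h⟩ := conv348_oneCubeYF_one (N := N) θ Mstar
  refine ⟨M₁, B₀, δ₀, hM₁, hB₀, hδ₀, fun 𝔏 bI hβ1 hlev x hM => ?_⟩
  exact schemas39_oneCube_of_conv348 _ _ r le_rfl (geo9Y_M_nonneg θ Mstar x) (h 𝔏 bI hβ1 hlev x hM)

end StageY

end Literature.MathematicalPhysics.QuantumFieldTheory.Balaban1983to89.B9Conv348AtOneLettersY

end
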